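import Mathlib
import HarnessLib

/-!
# Markman 2025 — the characteristic class `κ(ch) = exp(−ch₁/r)ch` ([M] §1.3) and the proof of COROLLARY 1.3.2
# («`κ(E)` is `Spin(V)_P`-invariant»): twist-invariance of `κ`, `ρ_g(κ(•)) = κ(ρ_g(•))`, and the upper square of
# Diagram (1.3.1) — the printed algebra, kernel-checked

E. Markman: [M] *Cycles on abelian 2n-folds of Weil type from secant sheaves on abelian n-folds*,
arXiv:2502.03415 **v2** (2025-06-08), bib `Markman2025SecantWeil` — UNREFEREED PREPRINT. Pages/lines = PyMuPDF lines
of the public v2 PDF (sha256/16 `8155aa33870069b8`), read at seat lit-w-markman g15 (pub-hsemireg LIT-W, 2026-08-23;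
sheet `LOCATOR-SHEET-MARKMAN.md` §48), BY EYE on 160-dpi renders `HOME/lit/Markman-renders-litw-markman-g15/`
`r_mar25_v2_p05_rho_prime_a.png`, `…p06_top_rho_prime.png`, `…p06_rho_prime_b.png`, `…p06_kappa_C132.png`,
`…p07_C132_end.png`; pre-filing statement read ×2 ACROSS SEATS (lit-3 g46: CONCUR, 0 statement-level findings; its locator
precision σ1 — p. 7 L7–22 in the PyMuPDF convention — is folded here). COROLLARY 1.3.2 is row M-Mk2 («CLASS-EXACTNESS
MECHANISM») of the pub-hsemireg LIT-W table.

## What is printed (verbatim, v2)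
* p. 5 L42–47 / p. 6 L3–10: «Let `m : Spin(V) → GL[H^*(X, ℤ)]` be the spin representation and define `m† : Spin(V) →
  GL[H^*(X, ℤ)]` by `m†_g = τm_gτ`. Let `ρ : Spin(V) → SO(V)` be the standard representation and denote the induced
  representation on `H^*(X × X̂, ℤ) ≅ ∧^*V` by `ρ` as well. Define the representation `ρ′ : Spin(V) →
  GL[H^*(X × X̂, ℤ)]` by `ρ′_g = exp(½[c₁(P) − ρ_g(c₁(P))]) ρ_g`, for all `g ∈ Spin(V)`. The two integral
  `Spin(V)`-representation `ρ` and `ρ′` are non-isomorphic, but they are isomorphic once tensored with `ℚ`, as the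
  upper square in the following diagram is commutative, for all `g ∈ Spin(V)`.» — Diagram (1.3.1), upper square:
  `H^*(X × X̂, ℚ) —ρ′_g→ H^*(X × X̂, ℚ)` below `H^*(X × X̂, ℚ) —ρ_g→ H^*(X × X̂, ℚ)`, both vertical maps
  `∪ exp(−½c₁(P))`.
* p. 6 L59–61: «Given a class `ch` in `H^{ev}(X × X̂, ℚ)` with graded summand `ch_i` in `H^{2i}(X × X̂, ℚ)` and with
  `ch₀ = r ≠ 0` considered as a rational number, set `κ(ch) = exp(−ch₁/r)ch`. Given an object in `D^b(X × X̂)` of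
  non-zero rank set `κ(E) := κ(ch(E))`.»
* COROLLARY 1.3.2 (p. 6 L63–67): «If the rank `r` of a `P`-secant^{⊠2}-object `E := Φ(F₁ ⊠ F₂^∨)` is non zero, then
  its characteristic class `κ(E)` is `Spin(V)_P`-invariant with respect to the representation `ρ`. Consequently, `κ(E)`
  remains of Hodge-type, under every deformations of `(X × X̂, η, h)` as a polarized abelian variety of Weil-type.»
  PROOF (p. 6 L68 – p. 7 L26): «Let `g` be an element of `Spin(V)_P`. Using the fact that `ρ_g` is an algebra
  automorphism we have `ρ_g(exp(•)) = exp(ρ_g(•))` and `ρ_g(κ(•)) = κ(ρ_g(•))`. The fact that `F₁` and `F₂` are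
  `P`-secant sheaves implies that `m_g ⊗ m†_g` leaves `ch(F₁ ⊗ F₂^∨)` invariant. Hence `ρ′_g(ch(E)) = ch(E)`, by
  Proposition 6.1.2. Thus `ch(E) ∪ exp(−½c₁(P))` is `ρ_g` invariant, `ch(E) ∪ exp(−½c₁(P)) = ρ_g(ch(E)) ∪
  exp(−½ρ_g(c₁(P)))`, by the commutativity of the upper square in Diagram (1.3.1). Applying `κ` to both sides, we get
  `κ(ch(E)) = κ(ρ_g(ch(E))) = ρ_g(κ(ch(E)))`. Hence, `κ(E) = ρ_g(κ(E))`. Finally, `Spin(V)_P`-invariant classes remain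
  of Hodge-type under every deformation of `(X × X̂, η, h)` as a polarized abelian variety of Weil-type, by Corollary
  4.0.4. □» (sic «`ch(F₁ ⊗ F₂^∨)`» for the `⊠`-product).

## The model (every input BY VALUE) and what this file proves (0 named facts, 0 sorry)
`A` = a commutative `ℚ`-algebra (for `H^{ev}(X × X̂, ℚ)`); the GRADED data enter only through the degree-`≤ 2`
truncation: `ε : A →ₐ[ℚ] ℚ` (the `H⁰`-component, «`ch₀ = r` considered as a rational number» — an algebra map) and
`δ : A →ₗ[ℚ] L` (the `H²`-component `ch₁`, valued in `L = H²`) with the Leibniz rule `δ(xy) = ε(x)δ(y) + ε(y)δ(x)`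
(degree bookkeeping of a graded-commutative product), and `s : L →ₗ[ℚ] A` the inclusion `H² ⊂ H^{ev}` with
`ε(s m) = 0`, `δ(s m) = m`, `s m` nilpotent. `exp` is Mathlib's `IsNilpotent.exp`. With `kappa ε δ s ch :=
exp(−(1/ε ch)·s(δ ch)) · ch` = «`κ(ch) = exp(−ch₁/r)ch`»:
`eps_exp_line` / `delta_exp_line` (`exp(ℓ)`, `ℓ ∈ H²`, has `H⁰`-component `1` and `H²`-component `ℓ`), `rank_twist` /
`c1_twist` (`(ch ∪ exp ℓ)₀ = r`, `(ch ∪ exp ℓ)₁ = ch₁ + rℓ`), **`kappa_twist`** (`κ(ch ∪ exp(ℓ)) = κ(ch)` for `r ≠ 0` —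
the step «Applying `κ` to both sides»), **`kappa_map`** («`ρ_g(κ(•)) = κ(ρ_g(•))`» for an algebra automorphism `ρ_g`
preserving the grading, via Mathlib's `ρ(exp(•)) = exp(ρ(•))`), **`upper_square`** (from `ρ′_g(ch) = ch` with
`ρ′_g = exp(½[c₁(P) − ρ_g(c₁(P))]) ρ_g`: `ch ∪ exp(−½c₁(P)) = ρ_g(ch) ∪ exp(−½ρ_g(c₁(P)))`), and
**`corollary_1_3_2`** (the printed chain `κ(ch(E)) = κ(ρ_g(ch(E))) = ρ_g(κ(ch(E)))` from `ρ′_g(ch(E)) = ch(E)`).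
BY VALUE (printed inputs, not modelled): Proposition 6.1.2 / 1.3.1 (`ρ′_g(ch(E)) = ch(E)`), the spin representations,
the grading of `H^{ev}` beyond its degree-`≤ 2` truncation, Corollary 4.0.4 (the Hodge-type consequence).
Nothing in this file says that HC / HC_CM / HC_AV is proved or that any object is semiregular or hyperholomorphic.
-/

namespace Literature.AlgebraicGeometry.Markman2025.KappaClass

open IsNilpotent

variable {A : Type*} [CommRing A] [Algebra ℚ A] {L : Type*} [AddCommGroup L] [Module ℚ L]

/-- «set `κ(ch) = exp(−ch₁/r)ch`», `r = ch₀ ≠ 0`: with `ε` = the `H⁰`-component (rank), `δ` = the `H²`-component and `s`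
the inclusion `H² ⊂ H^{ev}` (see the module docstring for the model). [cite: Markman2025SecantWeil, §1.3, p. 6 L59–61] -/
noncomputable def kappa (ε : A →ₐ[ℚ] ℚ) (δ : A →ₗ[ℚ] L) (s : L →ₗ[ℚ] A) (ch : A) : A :=
  exp (-((ε ch)⁻¹ • s (δ ch))) * ch

section Truncation

variable (ε : A →ₐ[ℚ] ℚ) (δ : A →ₗ[ℚ] L) (s : L →ₗ[ℚ] A)
  (hδ : ∀ x y, δ (x * y) = ε x • δ y + ε y • δ x) (hεs : ∀ m, ε (s m) = 0) (hδs : ∀ m, δ (s m) = m)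
  (hsn : ∀ m, IsNilpotent (s m))

/-- Degree bookkeeping: the `H²`-component of `1` vanishes (`δ(1) = δ(1·1) = 2δ(1)`). (helper) [folklore] -/
private theorem delta_one (hδ : ∀ x y, δ (x * y) = ε x • δ y + ε y • δ x) : δ 1 = 0 := by
  have h := hδ 1 1
  have e1 : ε 1 = 1 := map_one ε
  rw [mul_one, e1, one_smul] at h
  -- h : δ 1 = δ 1 + δ 1
  have : δ 1 + δ 1 = δ 1 + 0 := by rw [add_zero]; exact h.symm
  exact add_left_cancel this

/-- Degree bookkeeping: the `H²`-component of `ℓ^{i+2}` vanishes for `ℓ ∈ H²` (`ε(ℓ) = 0`). (helper) [folklore] -/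
private theorem delta_pow_add_two (hδ : ∀ x y, δ (x * y) = ε x • δ y + ε y • δ x) (hεs : ∀ m, ε (s m) = 0)
    (m : L) (i : ℕ) : δ (s m ^ (i + 1 + 1)) = 0 := by
  rw [_root_.pow_succ, hδ, map_pow, hεs, zero_pow (by omega), zero_smul, zero_smul, add_zero]

include hεs hsn in
/-- `exp(ℓ)`, `ℓ = s(m) ∈ H²`, has `H⁰`-component `1`: `ε(exp ℓ) = exp(ε ℓ) = exp(0) = 1` («`ρ(exp(•)) = exp(ρ(•))`» for
the algebra map `ε`). [cite: Markman2025SecantWeil, §1.3, p. 6 L59–61 / Corollary 1.3.2 (proof), p. 6 L68–69] -/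
theorem eps_exp_line (m : L) : ε (exp (s m)) = 1 := by
  rw [map_exp (hsn m) ε, hεs, exp_zero]

include hδ hεs hδs hsn in
/-- … and `H²`-component `m`: `δ(exp(s m)) = δ(1) + δ(s m) + Σ_{i≥2} δ((s m)^i)/i! = m`.
[cite: Markman2025SecantWeil, §1.3, p. 6 L59–61] -/
theorem delta_exp_line (m : L) : δ (exp (s m)) = m := by
  obtain ⟨k, hk⟩ := hsn m
  have hk2 : s m ^ (k + 2) = 0 := pow_eq_zero_of_le (by omega) hk
  rw [exp_eq_sum hk2, map_sum, Finset.sum_range_succ', Finset.sum_range_succ']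
  have hz : ∀ i ∈ Finset.range k, δ (((i + 1 + 1).factorial : ℚ)⁻¹ • s m ^ (i + 1 + 1)) = 0 := fun i _ => by
    rw [map_smul, delta_pow_add_two ε δ s hδ hεs m i, smul_zero]
  rw [Finset.sum_eq_zero hz]
  simp [hδs, delta_one ε δ hδ]

include hεs hsn in
/-- «with `ch₀ = r`»: twisting by `exp(ℓ)` does not change the rank, `(ch ∪ exp ℓ)₀ = r`.
[cite: Markman2025SecantWeil, §1.3, p. 6 L59–61 / Corollary 1.3.2 (proof), p. 7 L7–22] -/
theorem rank_twist (ch : A) (m : L) : ε (ch * exp (s m)) = ε ch := by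
  rw [map_mul, eps_exp_line ε s hεs hsn m, mul_one]

include hδ hεs hδs hsn in
/-- … and `(ch ∪ exp ℓ)₁ = ch₁ + r·ℓ` (the `H²`-component of a twist).
[cite: Markman2025SecantWeil, §1.3, p. 6 L59–61 / Corollary 1.3.2 (proof), p. 7 L7–22] -/
theorem c1_twist (ch : A) (m : L) : δ (ch * exp (s m)) = δ ch + ε ch • m := by
  rw [hδ, eps_exp_line ε s hεs hsn m, delta_exp_line ε δ s hδ hεs hδs hsn m, one_smul, add_comm]

include hδ hεs hδs hsn in
/-- TWIST INVARIANCE of `κ` — the content of «Applying `κ` to both sides»: for `r = ch₀ ≠ 0` and `ℓ ∈ H²`,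
`κ(ch ∪ exp(ℓ)) = exp(−(ch₁ + rℓ)/r)·ch·exp(ℓ) = exp(−ch₁/r)·exp(−ℓ)·exp(ℓ)·ch = κ(ch)`.
[cite: Markman2025SecantWeil, Corollary 1.3.2 (proof), p. 7 L7–22] -/
theorem kappa_twist (ch : A) (hr : ε ch ≠ 0) (m : L) :
    kappa ε δ s (ch * exp (s m)) = kappa ε δ s ch := by
  unfold kappa
  rw [rank_twist ε s hεs hsn, c1_twist ε δ s hδ hεs hδs hsn, map_add, map_smul, smul_add, smul_smul,
    inv_mul_cancel₀ hr, one_smul, neg_add]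
  have hn1 : IsNilpotent (-((ε ch)⁻¹ • s (δ ch))) := ((hsn _).smul _).neg
  have hn2 : IsNilpotent (-(s m)) := (hsn m).neg
  rw [exp_add_of_commute (Commute.all _ _) hn1 hn2, mul_assoc, mul_left_comm (exp (-(s m))),
    exp_neg_mul_exp_self (hsn m), mul_one]

end Truncation

section Equivariance

variable (ε : A →ₐ[ℚ] ℚ) (δ : A →ₗ[ℚ] L) (s : L →ₗ[ℚ] A) (hsn : ∀ m, IsNilpotent (s m))
  (ρ : A →ₐ[ℚ] A) (ρL : L →ₗ[ℚ] L) (hρε : ∀ x, ε (ρ x) = ε x) (hρδ : ∀ x, δ (ρ x) = ρL (δ x))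
  (hρs : ∀ m, ρ (s m) = s (ρL m))

include hsn hρε hρδ hρs in
/-- «Using the fact that `ρ_g` is an algebra automorphism we have `ρ_g(exp(•)) = exp(ρ_g(•))` and `ρ_g(κ(•)) =
κ(ρ_g(•))`» — for an algebra endomorphism `ρ` preserving the grading (it fixes ranks, `ε ∘ ρ = ε`, and acts on `H²`
through `ρL` compatibly with `δ` and `s`). [cite: Markman2025SecantWeil, Corollary 1.3.2 (proof), p. 6 L68–69] -/
theorem kappa_map (ch : A) : kappa ε δ s (ρ ch) = ρ (kappa ε δ s ch) := by
  unfold kappa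
  rw [map_mul, hρε, hρδ, ← hρs, map_exp ((hsn _).smul _).neg ρ, map_neg, map_smul]

/-- THE UPPER SQUARE OF DIAGRAM (1.3.1): with «`ρ′_g = exp(½[c₁(P) − ρ_g(c₁(P))]) ρ_g`», the invariance
`ρ′_g(ch(E)) = ch(E)` gives «`ch(E) ∪ exp(−½c₁(P)) = ρ_g(ch(E)) ∪ exp(−½ρ_g(c₁(P)))`» (here `P = c₁(P)` nilpotent).
[cite: Markman2025SecantWeil, Corollary 1.3.2 (proof), p. 7 L7–21; (1.3.1), p. 6 L3–11] -/
theorem upper_square (P ch : A) (hP : IsNilpotent P)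
    (h : exp ((1 / 2 : ℚ) • (P - ρ P)) * ρ ch = ch) :
    ch * exp (-((1 / 2 : ℚ) • P)) = ρ ch * exp (-((1 / 2 : ℚ) • ρ P)) := by
  have hPn : IsNilpotent ((1 / 2 : ℚ) • P) := hP.smul _
  have hdiff : IsNilpotent ((1 / 2 : ℚ) • (P - ρ P)) := ((Commute.all _ _).isNilpotent_sub hP (hP.map ρ)).smul _
  conv_lhs => rw [← h]
  rw [mul_right_comm, ← exp_add_of_commute (Commute.all _ _) hdiff hPn.neg, mul_comm]
  congr 2
  rw [smul_sub]
  abel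

include hsn hρε hρδ hρs in
/-- COROLLARY 1.3.2, the printed chain: from `ρ′_g(ch(E)) = ch(E)` (Proposition 6.1.2, BY VALUE as the hypothesis `h`)
and `r = ch₀ ≠ 0`: «`κ(ch(E)) = κ(ρ_g(ch(E))) = ρ_g(κ(ch(E)))`. Hence, `κ(E) = ρ_g(κ(E))`.» — with `c₁(P) = s(p) ∈ H²`
and the truncation axioms of the model. [cite: Markman2025SecantWeil, Corollary 1.3.2, p. 6 L63 – p. 7 L23] -/
theorem corollary_1_3_2 (hδ : ∀ x y, δ (x * y) = ε x • δ y + ε y • δ x) (hεs : ∀ m, ε (s m) = 0)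
    (hδs : ∀ m, δ (s m) = m) (p : L) (ch : A) (hr : ε ch ≠ 0)
    (h : exp ((1 / 2 : ℚ) • (s p - ρ (s p))) * ρ ch = ch) :
    kappa ε δ s ch = kappa ε δ s (ρ ch) ∧ kappa ε δ s (ρ ch) = ρ (kappa ε δ s ch) := by
  refine ⟨?_, kappa_map ε δ s hsn ρ ρL hρε hρδ hρs ch⟩
  have hsq := upper_square ρ (s p) ch (hsn p) h
  -- rewrite the two twists as `exp (s ℓ)` for `ℓ ∈ H²`
  have e1 : -((1 / 2 : ℚ) • s p) = s (-((1 / 2 : ℚ) • p)) := by rw [map_neg, map_smul]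
  have e2 : -((1 / 2 : ℚ) • ρ (s p)) = s (-((1 / 2 : ℚ) • ρL p)) := by rw [hρs, map_neg, map_smul]
  rw [e1, e2] at hsq
  have hrρ : ε (ρ ch) ≠ 0 := by rwa [hρε]
  calc kappa ε δ s ch = kappa ε δ s (ch * exp (s (-((1 / 2 : ℚ) • p)))) :=
        (kappa_twist ε δ s hδ hεs hδs hsn ch hr _).symm
    _ = kappa ε δ s (ρ ch * exp (s (-((1 / 2 : ℚ) • ρL p)))) := by rw [hsq]
    _ = kappa ε δ s (ρ ch) := kappa_twist ε δ s hδ hεs hδs hsn (ρ ch) hrρ _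

end Equivariance

end Literature.AlgebraicGeometry.Markman2025.KappaClass
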